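import Literature.AlgebraicGeometry.GroupSchemes.GroupSchemeActionOfPoints
import Mathlib.AlgebraicGeometry.Morphisms.Finite
import Mathlib.AlgebraicGeometry.PullbackCarrier
import Mathlib.AlgebraicGeometry.ResidueField
import Mathlib.CategoryTheory.Monoidal.Cartesian.Over
import Mathlib.CategoryTheory.Monoidal.Cartesian.Grp
import HarnessLib

/-!
# Orbits of points under a group-scheme action: the action shear, finiteness of the action map,
# and the orbit relation on points (reflexive, symmetric, transitive)

Mathlib currency: `[GrpObj G] [ModObj G X]` in a cartesian monoidal category, then in `Over S`.

* `isIso_lift_fst_smul` — the ACTION SHEAR `(g, x) ↦ (g, g • x)` on `G ⊗ X` is an isomorphism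
  (inverse `(g, y) ↦ (g, g⁻¹ • y)`); hence `γ = shear ≫ pr₂` and
* `isFinite_smul_left` — over a scheme `S`, if `pr₂ : G ×_S X → X` is finite (e.g. `G → S` finite,
  `isFinite_snd_left`) then so is the action map `σ : G ×_S X → X`;
* the ORBIT RELATION on points of the underlying spaces, `y ⤳ z :⇔ ∃ p ∈ G ×_S X, pr₂ p = y ∧ σ p = z`,
  is reflexive (`exists_point_smul_self`), symmetric (`exists_point_smul_symm`) and transitive
  (`exists_point_smul_trans`) — the last through the cartesian square
  `(G ◁ σ, pr₂) : G ×_S (G ×_S X) ⇉ G ×_S X` over `(pr₂, σ)` (`isPullback_whiskerLeft_smul_left`) and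
  Mathlib's `Scheme.exists_preimage_of_isPullback`;
* `smul_image_snd_preimage_compl_eq` / `isOpen_saturationCompl` / stability lemmas: for a set `F` of
  points of `X`, the SATURATION `σ(pr₂⁻¹ F)` is the set of points in the orbit of a point of `F`; its
  complement `{y | orbit(y) ⊆ Fᶜ}` is open when `F` is closed and `σ` is finite (closed map), and is
  stable.

These are the point-set steps of Mumford's construction of stable affine neighbourhoods for the
action of a finite group scheme (*Abelian Varieties* §12, proof of Thm. 1; SGA 3 V §5).
THEOREMS ONLY; no definition, no instance, no sorry.

## References
* [MumfordAV1970] D. Mumford, *Abelian Varieties* (1970), §12 Thm. 1 (p. 111) and its proof (p. 112).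
* [GortzWedhorn2020] U. Görtz, T. Wedhorn, *Algebraic Geometry I* (2020), Def. 4.44 (p. 117).
-/

noncomputable section

universe v u

open CategoryTheory Limits MonoidalCategory CartesianMonoidalCategory AlgebraicGeometry
open scoped MonObj

namespace Literature.AlgebraicGeometry.GroupSchemes.ActionOrbit

/-! ## §1 The action shear is an isomorphism (any cartesian monoidal category) -/

section Shear

variable {C : Type u} [Category.{v} C] [CartesianMonoidalCategory C] {G X : C} [GrpObj G] [ModObj G X]

/-- On `T`-valued points, `⟨g, x⟩ ≫ ⟨p₁, γ⟩ = ⟨g, g • x⟩`. [cite: GortzWedhorn2020, Def. 4.44 (p. 117)] -/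
theorem lift_comp_lift_fst_smul {T : C} (g : T ⟶ G) (x : T ⟶ X) :
    lift g x ≫ lift (fst G X) γ[G, X] = lift g (g • x) := by
  rw [comp_lift, lift_fst, smul_eq_lift_comp]

/-- On `T`-valued points, `⟨g, y⟩ ≫ ⟨p₁, ⟨p₁⁻¹, p₂⟩ ≫ γ⟩ = ⟨g, g⁻¹ • y⟩`. [cite: GortzWedhorn2020, Def. 4.44 (p. 117)] -/
theorem lift_comp_lift_fst_invSmul {T : C} (g : T ⟶ G) (y : T ⟶ X) :
    lift g y ≫ lift (fst G X) (lift (fst G X ≫ ι[G]) (snd G X) ≫ γ[G, X]) = lift g (g⁻¹ • y) := by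
  rw [comp_lift, lift_fst, ← Category.assoc, comp_lift, lift_snd, ← Category.assoc, lift_fst,
    smul_eq_lift_comp, Hom.inv_def]

/-- **The action shear `(g, x) ↦ (g, g • x)` is an isomorphism** of `G ⊗ X`, with inverse
`(g, y) ↦ (g, g⁻¹ • y)`. [cite: MumfordAV1970, §12 proof of Thm. 1 (p. 112)] -/
theorem isIso_lift_fst_smul : IsIso (lift (fst G X) γ[G, X]) := by
  refine ⟨⟨lift (fst G X) (lift (fst G X ≫ ι[G]) (snd G X) ≫ γ[G, X]), ?_, ?_⟩⟩
  · apply hom_tensor_ext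
    intro T g x
    rw [Category.comp_id, ← Category.assoc, lift_comp_lift_fst_smul, lift_comp_lift_fst_invSmul,
      ← mul_smul, inv_mul_cancel, one_smul]
  · apply hom_tensor_ext
    intro T g y
    rw [Category.comp_id, ← Category.assoc, lift_comp_lift_fst_invSmul, lift_comp_lift_fst_smul,
      ← mul_smul, mul_inv_cancel, one_smul]

/-- `γ = ⟨p₁, γ⟩ ≫ p₂`: the action map is the action shear followed by the second projection.
[cite: MumfordAV1970, §12 proof of Thm. 1 (p. 112)] -/
theorem smul_eq_lift_fst_smul_comp_snd : γ[G, X] = lift (fst G X) γ[G, X] ≫ snd G X := by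
  rw [lift_snd]

/-- `⟨p₁⁻¹, γ⟩ ≫ γ = p₂`: `g⁻¹ • (g • x) = x` read on the universal point. [cite: GortzWedhorn2020, Def. 4.44 (p. 117)] -/
theorem lift_fst_inv_smul_comp_smul : lift (fst G X ≫ ι[G]) γ[G, X] ≫ γ[G, X] = snd G X := by
  have h : γ[G, X] = (fst G X) • (snd G X) := by
    rw [smul_eq_lift_comp, lift_fst_snd, Category.id_comp]
  rw [← smul_eq_lift_comp, ← Hom.inv_def, h, ← mul_smul, inv_mul_cancel, one_smul]

/-- `⟨p₁ · (p₂ ≫ p₁), p₂ ≫ p₂⟩ ≫ γ = (G ◁ γ) ≫ γ` on `G ⊗ (G ⊗ X)`: `(g h) • w = g • (h • w)` read on the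
universal point. [cite: GortzWedhorn2020, Def. 4.44 (p. 117)] -/
theorem lift_mul_comp_smul_eq_whiskerLeft_comp_smul :
    lift (fst G (G ⊗ X) * (snd G (G ⊗ X) ≫ fst G X)) (snd G (G ⊗ X) ≫ snd G X) ≫ γ[G, X] =
      (G ◁ γ[G, X]) ≫ γ[G, X] := by
  have hW : G ◁ γ[G, X] = lift (fst G (G ⊗ X)) (snd G (G ⊗ X) ≫ γ[G, X]) := by
    apply CartesianMonoidalCategory.hom_ext <;> simp
  rw [hW, ← smul_eq_lift_comp, mul_smul, ← smul_eq_lift_comp]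
  congr 1
  rw [smul_eq_lift_comp, ← comp_lift, Category.assoc, lift_fst_snd, Category.id_comp]

end Shear

/-! ## §2 Over a scheme: finiteness of the action map; the cartesian square `(G ◁ γ, p₂; p₂, γ)` -/

section OverScheme

variable {S : Scheme.{u}} {G X : Over S} [GrpObj G] [ModObj G X]

omit [GrpObj G] [ModObj G X] in
/-- `pr₂ : G ×_S X → X` is finite when `G → S` is. [cite: MumfordAV1970, §12 proof of Thm. 1 (p. 112)] -/
theorem isFinite_snd_left [IsFinite G.hom] : IsFinite (snd G X).left := by
  rw [Over.snd_left]
  exact MorphismProperty.pullback_snd (P := @IsFinite) G.hom X.hom inferInstance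

/-- **The action map `σ : G ×_S X → X` is finite when `pr₂` is** (`σ = shear ≫ pr₂`, the shear an
isomorphism). [cite: MumfordAV1970, §12 proof of Thm. 1 (p. 112)] -/
theorem isFinite_smul_left [IsFinite (snd G X).left] : IsFinite (γ[G, X]).left := by
  rw [smul_eq_lift_fst_smul_comp_snd (G := G) (X := X), Over.comp_left]
  haveI := isIso_lift_fst_smul (G := G) (X := X)
  haveI : IsIso (lift (fst G X) γ[G, X]).left :=
    (inferInstance : IsIso ((Over.forget S).map (lift (fst G X) γ[G, X])))
  infer_instance

/-- The square of schemes `(G ◁ γ).left, pr₂.left ; pr₂.left, γ.left` is cartesian: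
`G ×_S (G ×_S X) → G ×_S X`, `(g, (h, w)) ↦ (g, h • w)` is the base change of `σ` along `pr₂`.
[cite: MumfordAV1970, §12 proof of Thm. 1 (p. 112)] -/
theorem isPullback_whiskerLeft_smul_left :
    IsPullback (G ◁ γ[G, X]).left (snd G (G ⊗ X)).left (snd G X).left (γ[G, X]).left := by
  rw [Over.snd_left, Over.snd_left]
  refine IsPullback.of_right ?_ (Over.whiskerLeft_left_snd γ[G, X]) (IsPullback.of_hasPullback G.hom X.hom)
  rw [Over.whiskerLeft_left_fst, Over.w γ[G, X]]
  exact IsPullback.of_hasPullback G.hom (G ⊗ X).hom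

/-! ## §3 The orbit relation on points -/

/-- **Reflexivity**: every point `y` of `X` is `pr₂ p` and `σ p` for the point `p = (1, y)` of
`G ×_S X` (the `κ(y)`-valued point `⟨1, y⟩`). [cite: MumfordAV1970, §12 proof of Thm. 1 (p. 112)] -/
theorem exists_point_smul_self (y : X.left) :
    ∃ p : ↑(G ⊗ X).left, (snd G X).left p = y ∧ (γ[G, X]).left p = y := by
  let T : Over S := Over.mk (X.left.fromSpecResidueField y ≫ X.hom)
  let xT : T ⟶ X := Over.homMk (X.left.fromSpecResidueField y) rfl
  let pt : ↑T.left := IsLocalRing.closedPoint (X.left.residueField y)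
  refine ⟨(lift (1 : T ⟶ G) xT).left pt, ?_, ?_⟩
  · rw [← Scheme.Hom.comp_apply, ← Over.comp_left, lift_snd]
    exact Scheme.fromSpecResidueField_apply y pt
  · rw [← Scheme.Hom.comp_apply, ← Over.comp_left, lift_one_comp_smul]
    exact Scheme.fromSpecResidueField_apply y pt

/-- **Symmetry**: if `p = (g, y)` has `σ p = z` then `p′ = (g⁻¹, z)` has `pr₂ p′ = z`, `σ p′ = y`.
[cite: MumfordAV1970, §12 proof of Thm. 1 (p. 112)] -/
theorem exists_point_smul_symm {y z : X.left}
    (h : ∃ p : ↑(G ⊗ X).left, (snd G X).left p = y ∧ (γ[G, X]).left p = z) :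
    ∃ p : ↑(G ⊗ X).left, (snd G X).left p = z ∧ (γ[G, X]).left p = y := by
  obtain ⟨p, hpy, hpz⟩ := h
  refine ⟨(lift (fst G X ≫ ι[G]) γ[G, X]).left p, ?_, ?_⟩
  · rw [← Scheme.Hom.comp_apply, ← Over.comp_left, lift_snd, hpz]
  · rw [← Scheme.Hom.comp_apply, ← Over.comp_left, lift_fst_inv_smul_comp_smul, hpy]

/-- **Transitivity**: if `pr₂ p = y` and `pr₂ q = σ p` then some `r` has `pr₂ r = y` and `σ r = σ q`
(`r = (h g, w)` for `p = (g, w)`, `q = (h, g • w)`, found in the cartesian square of §2).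
[cite: MumfordAV1970, §12 proof of Thm. 1 (p. 112)] -/
theorem exists_point_smul_trans {y : X.left} {p q : ↑(G ⊗ X).left}
    (hp : (snd G X).left p = y) (hq : (snd G X).left q = (γ[G, X]).left p) :
    ∃ r : ↑(G ⊗ X).left, (snd G X).left r = y ∧ (γ[G, X]).left r = (γ[G, X]).left q := by
  obtain ⟨t, htq, htp⟩ := Scheme.exists_preimage_of_isPullback
    (isPullback_whiskerLeft_smul_left (G := G) (X := X)) q p hq
  refine ⟨(lift (fst G (G ⊗ X) * (snd G (G ⊗ X) ≫ fst G X)) (snd G (G ⊗ X) ≫ snd G X)).left t, ?_, ?_⟩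
  · rw [← Scheme.Hom.comp_apply, ← Over.comp_left, lift_snd, Over.comp_left, Scheme.Hom.comp_apply]
    rw [htp, hp]
  · rw [← Scheme.Hom.comp_apply, ← Over.comp_left, lift_mul_comp_smul_eq_whiskerLeft_comp_smul,
      Over.comp_left, Scheme.Hom.comp_apply]
    change (γ[G, X]).left ((G ◁ γ[G, X]).left t) = _
    rw [htq]

/-! ## §4 Saturation of a set of points and its stable open complement -/

/-- The SATURATION `σ(pr₂⁻¹ F)` of a set of points `F ⊆ X` is the set of points `z` in the orbit of
some point of `F`. [cite: MumfordAV1970, §12 proof of Thm. 1 (p. 112)] -/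
theorem mem_smul_image_snd_preimage_iff (F : Set X.left) (z : X.left) :
    z ∈ (γ[G, X]).left '' ((snd G X).left ⁻¹' F) ↔
      ∃ p : ↑(G ⊗ X).left, (snd G X).left p ∈ F ∧ (γ[G, X]).left p = z :=
  Iff.rfl

/-- **The complement of the saturation of `F` is `{y | orbit(y) ⊆ Fᶜ}`** (symmetry of the orbit
relation). [cite: MumfordAV1970, §12 proof of Thm. 1 (p. 112)] -/
theorem notMem_smul_image_snd_preimage_iff (F : Set X.left) (y : X.left) :
    y ∉ (γ[G, X]).left '' ((snd G X).left ⁻¹' F) ↔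
      ∀ p : ↑(G ⊗ X).left, (snd G X).left p = y → (γ[G, X]).left p ∉ F := by
  rw [mem_smul_image_snd_preimage_iff]
  constructor
  · intro h p hpy hmem
    obtain ⟨p', hp'1, hp'2⟩ := exists_point_smul_symm (G := G) (X := X) ⟨p, hpy, rfl⟩
    exact h ⟨p', hp'1.symm ▸ hmem, hp'2⟩
  · rintro h ⟨p, hpF, hpy⟩
    obtain ⟨p', hp'1, hp'2⟩ := exists_point_smul_symm (G := G) (X := X) ⟨p, rfl, hpy⟩
    exact h p' hp'1 (hp'2.symm ▸ hpF)

/-- **The complement of the saturation of a closed set is open** when the action map is finite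
(a finite morphism is closed). [cite: MumfordAV1970, §12 proof of Thm. 1 (p. 112)] -/
theorem isOpen_compl_smul_image_snd_preimage [IsFinite (γ[G, X]).left] {F : Set X.left} (hF : IsClosed F) :
    IsOpen ((γ[G, X]).left '' ((snd G X).left ⁻¹' F))ᶜ := by
  rw [isOpen_compl_iff]
  exact (γ[G, X]).left.isClosedMap _ (hF.preimage (snd G X).left.continuous)

/-- **The complement of a saturation is stable**: if `orbit(y) ⊆ Fᶜ` and `pr₂ p = y` then
`orbit(σ p) ⊆ Fᶜ` (transitivity). [cite: MumfordAV1970, §12 proof of Thm. 1 (p. 112)] -/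
theorem smul_mem_compl_of_snd_mem_compl (F : Set X.left) {p : ↑(G ⊗ X).left}
    (hy : (snd G X).left p ∈ ((γ[G, X]).left '' ((snd G X).left ⁻¹' F))ᶜ) :
    (γ[G, X]).left p ∈ ((γ[G, X]).left '' ((snd G X).left ⁻¹' F))ᶜ := by
  rw [Set.mem_compl_iff, notMem_smul_image_snd_preimage_iff] at hy ⊢
  intro q hq
  obtain ⟨r, hr1, hr2⟩ := exists_point_smul_trans (G := G) (X := X) rfl hq
  rw [← hr2]
  exact hy r hr1

/-- The complement of the saturation of `F` lies in `Fᶜ` (reflexivity). [cite: MumfordAV1970, §12 proof of Thm. 1 (p. 112)] -/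
theorem compl_smul_image_snd_preimage_subset (F : Set X.left) :
    ((γ[G, X]).left '' ((snd G X).left ⁻¹' F))ᶜ ⊆ Fᶜ := by
  intro y hy hyF
  rw [Set.mem_compl_iff, notMem_smul_image_snd_preimage_iff] at hy
  obtain ⟨p, hp1, hp2⟩ := exists_point_smul_self (G := G) (X := X) y
  exact hy p hp1 (hp2.symm ▸ hyF)

/-- A point whose orbit lies in `Fᶜ` is in the complement of the saturation of `F`.
[cite: MumfordAV1970, §12 proof of Thm. 1 (p. 112)] -/
theorem mem_compl_smul_image_snd_preimage_of_forall (F : Set X.left) {y : X.left}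
    (h : ∀ p : ↑(G ⊗ X).left, (snd G X).left p = y → (γ[G, X]).left p ∉ F) :
    y ∈ ((γ[G, X]).left '' ((snd G X).left ⁻¹' F))ᶜ := by
  rw [Set.mem_compl_iff, notMem_smul_image_snd_preimage_iff]
  exact h

end OverScheme

end Literature.AlgebraicGeometry.GroupSchemes.ActionOrbit

end
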